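import Literature.Topology.FourManifolds.TrisectionsTopHeight
import Literature.Topology.FourManifolds.FlowFibreMorseAlgebra
import HarnessLib

/-!
# Band calculus for the sector functions: flow-invariance of the top height, derivatives along
# the field, and Morse data of `φ ∘ f`

Topic `Literature/Topology/FourManifolds`; step E4a of a Morse-theoretic construction of
Gay–Kirby's trisection for the fact seat
`provefact-Literature.Topology.FourManifolds.exists_isBalancedGKTrisection` (Gay–Kirby 2016,
Thm. 4 via §4, Lemma 14).  Everything in this file is **proved**; there are no new definitions.

* `HandleBoxes.topRaw_flow_eventuallyEq` / `topHeight_flow_eventuallyEq` — on the band (resp.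
  its plateau `{χ_lo(s) = χ_hi(s) = 1}`), the top height is constant along every orbit for small
  times; hence **`ξ(T) = 0`** there (`mlineDeriv_topHeight_eq_zero`).
* `mlineDeriv_comp₂_topHeight` — for `Ψ = Γ(T, f)`: `ξ(Ψ) = ∂₂Γ(T z, f z) · ξ(f)`; with
  `ξ(f) > 0` off the critical points of `f`, **`Ψ` has no critical point where `∂₂Γ ≠ 0`**
  (`not_isMCriticalPt_comp₂_topHeight`) — the mechanism excluding critical points of the
  first and third sector functions in the band.
* `morseData_real_comp` — at a critical point of `f`, `φ ∘ f` (with `φ' ≠ 0`) is critical, is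
  nondegenerate iff `f` is, and has index `index f` if `φ' > 0`, `dim - index f` if `φ' < 0`
  (second-order chain rule at a critical point; Milnor 1963, §2).

## References

* J. Milnor, *Morse theory* (1963), §2–§3. [Milnor1963]
* J. Milnor, *Lectures on the h-cobordism theorem* (1965), Def. 3.1, Thm. 3.4. [MilnorHCobordism1965]
* D. Gay, R. Kirby, *Trisecting 4-manifolds*, Geom. Topol. 20 (2016), §4, Lemma 14. [GayKirby2016]
-/

open scoped Manifold ContDiff Topology
open Set Function Filter Metric

noncomputable section

universe u

namespace Literature.Topology.FourManifolds

open Flow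

/-- Local notation: `𝔼 n` is the model Euclidean space `EuclideanSpace ℝ (Fin n)`. -/
local notation "𝔼 " n:arg => EuclideanSpace ℝ (Fin n)

/-! ### Morse data of `φ ∘ f` at a critical point of `f` -/

section RealComp

variable {m : ℕ} {M : Type u} [TopologicalSpace M] [ChartedSpace (𝔼 (m + 1)) M]
  [IsManifold (𝓡 (m + 1)) ∞ M]

omit [IsManifold (𝓡 (m + 1)) ∞ M] in
/-- Chain rule for `φ ∘ f` (manifold derivative). [folklore] -/
theorem hasMFDerivAt_real_comp' {f : M → ℝ} {φ : ℝ → ℝ} {d : ℝ} {z : M}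
    (hφ : HasDerivAt φ d (f z)) (hf : MDifferentiableAt (𝓡 (m + 1)) 𝓘(ℝ, ℝ) f z) :
    HasMFDerivAt (𝓡 (m + 1)) 𝓘(ℝ, ℝ) (fun y => φ (f y)) z
      ((ContinuousLinearMap.smulRight (1 : ℝ →L[ℝ] ℝ) d).comp (mfderiv (𝓡 (m + 1)) 𝓘(ℝ, ℝ) f z)) :=
  HasMFDerivAt.comp z hφ.hasFDerivAt.hasMFDerivAt hf.hasMFDerivAt

omit [IsManifold (𝓡 (m + 1)) ∞ M] in
/-- Chain rule for the derivative along a tangent vector of `φ ∘ f`. [folklore] -/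
theorem mlineDeriv_real_comp' {f : M → ℝ} {φ : ℝ → ℝ} {d : ℝ} {z : M}
    (hφ : HasDerivAt φ d (f z)) (hf : MDifferentiableAt (𝓡 (m + 1)) 𝓘(ℝ, ℝ) f z)
    (v : TangentSpace (𝓡 (m + 1)) z) :
    mlineDeriv (𝓡 (m + 1)) (fun y => φ (f y)) z v = d * mlineDeriv (𝓡 (m + 1)) f z v := by
  rw [mlineDeriv_def, (hasMFDerivAt_real_comp' hφ hf).mfderiv]
  change (show ℝ from mfderiv (𝓡 (m + 1)) 𝓘(ℝ, ℝ) f z v) * d = d * _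
  rw [mul_comm]

omit [IsManifold (𝓡 (m + 1)) ∞ M] in
/-- `φ ∘ f` is critical at `z` iff `f` is, when `φ'(f z) ≠ 0`. [folklore] -/
theorem isMCriticalPt_real_comp_iff' {f : M → ℝ} {φ : ℝ → ℝ} {d : ℝ} {z : M}
    (hφ : HasDerivAt φ d (f z)) (hd : d ≠ 0) (hf : MDifferentiableAt (𝓡 (m + 1)) 𝓘(ℝ, ℝ) f z) :
    IsMCriticalPt (𝓡 (m + 1)) (fun y => φ (f y)) z ↔ IsMCriticalPt (𝓡 (m + 1)) f z := by
  have key : ∀ v, mlineDeriv (𝓡 (m + 1)) (fun y => φ (f y)) z v = d * mlineDeriv (𝓡 (m + 1)) f z v :=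
    mlineDeriv_real_comp' hφ hf
  constructor
  · intro h0
    unfold IsMCriticalPt at h0 ⊢
    ext v
    have := key v
    rw [mlineDeriv_def, h0] at this
    have h1 : mlineDeriv (𝓡 (m + 1)) f z v = 0 := by
      have : d * mlineDeriv (𝓡 (m + 1)) f z v = 0 := by rw [← this]; rfl
      exact (mul_eq_zero.1 this).resolve_left hd
    rw [mlineDeriv_def] at h1
    exact h1
  · intro h0
    unfold IsMCriticalPt at h0 ⊢
    ext v
    have := key v
    rw [mlineDeriv_def, mlineDeriv_def, h0] at this
    rw [this]
    exact mul_zero d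

/-- **The chart Hessian of `φ ∘ f` at a critical point of `f` is `φ'(f z)` times that of `f`.**
[cite: Milnor1963, §2] -/
theorem hessianInChart_real_comp_apply {f : M → ℝ} {φ : ℝ → ℝ} {z : M}
    (hφ : ContDiffAt ℝ 2 φ (f z)) (hf : ContMDiffAt (𝓡 (m + 1)) 𝓘(ℝ, ℝ) 2 f z)
    (hz : IsMCriticalPt (𝓡 (m + 1)) f z)
    {e : OpenPartialHomeomorph M (𝔼 (m + 1))} (he : e ∈ IsManifold.maximalAtlas (𝓡 (m + 1)) ∞ M)
    (hze : z ∈ e.source) (v w : 𝔼 (m + 1)) :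
    hessianInChart (𝓡 (m + 1)) e (fun y => φ (f y)) z v w =
      deriv φ (f z) * hessianInChart (𝓡 (m + 1)) e f z v w := by
  have he2 : e ∈ IsManifold.maximalAtlas (𝓡 (m + 1)) 2 M := IsManifold.maximalAtlas_subset_of_le (by norm_cast) he
  -- `f ∘ e⁻¹` is `C²` at `e z` with vanishing derivative
  have hτ : ContDiffAt ℝ 2 (f ∘ e.symm) (e z) := by
    have := contDiffAt_comp_extend_symm hf he2 hze
    simpa using this
  have hτ0 : fderiv ℝ (f ∘ e.symm) (e z) = 0 :=
    (isMCriticalPt_iff_fderiv_comp_symm_eq_zero (contMDiffOn_of_mem_maximalAtlas he)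
      (contMDiffOn_symm_of_mem_maximalAtlas he) hze (hf.mdifferentiableAt (by norm_cast))).1 hz
  have hfz : (f ∘ e.symm) (e z) = f z := by simp [e.left_inv hze]
  have hφ' : ContDiffAt ℝ 2 φ ((f ∘ e.symm) (e z)) := by rw [hfz]; exact hφ
  rw [RegularLevel.hessianInChart_apply_eq, RegularLevel.hessianInChart_apply_eq,
    show ((fun y => φ (f y)) ∘ e.symm) = φ ∘ (f ∘ e.symm) from rfl,
    fderiv_fderiv_comp_apply hφ' hτ v w, hτ0]
  simp only [zero_apply, map_zero, zero_add, hfz]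
  -- `Dφ(f z)(r) = φ'(f z) r`
  have : fderiv ℝ φ (f z) (fderiv ℝ (fderiv ℝ (f ∘ e.symm)) (e z) v w) =
      deriv φ (f z) * fderiv ℝ (fderiv ℝ (f ∘ e.symm)) (e z) v w := by
    rw [← toSpanSingleton_deriv, ContinuousLinearMap.toSpanSingleton_apply, smul_eq_mul, mul_comm]
  rw [this]

/-- **Morse data of `φ ∘ f` at a critical point of `f`** (`φ'(f z) ≠ 0`, `f` and `φ` of class
`C²`): `φ ∘ f` is critical at `z`; its Hessian is nondegenerate iff that of `f` is; its index is
that of `f` if `φ' > 0` and `dim M - index f` if `φ' < 0` (and `f` is nondegenerate at `z`).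
[cite: Milnor1963, §2–§3] -/
theorem morseData_real_comp {f : M → ℝ} {φ : ℝ → ℝ} {z : M}
    (hφ : ContDiffAt ℝ 2 φ (f z)) (hf : ContMDiffAt (𝓡 (m + 1)) 𝓘(ℝ, ℝ) 2 f z)
    (hz : IsMCriticalPt (𝓡 (m + 1)) f z) (hd : deriv φ (f z) ≠ 0) :
    IsMCriticalPt (𝓡 (m + 1)) (fun y => φ (f y)) z ∧
      ((mhessian (𝓡 (m + 1)) (fun y => φ (f y)) z).Nondegenerate ↔ (mhessian (𝓡 (m + 1)) f z).Nondegenerate) ∧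
      (0 < deriv φ (f z) → morseIndex (𝓡 (m + 1)) (fun y => φ (f y)) z = morseIndex (𝓡 (m + 1)) f z) ∧
      (deriv φ (f z) < 0 → (mhessian (𝓡 (m + 1)) f z).Nondegenerate →
        morseIndex (𝓡 (m + 1)) (fun y => φ (f y)) z + morseIndex (𝓡 (m + 1)) f z = m + 1) := by
  set e := chartAt (𝔼 (m + 1)) z with he_def
  have he : e ∈ IsManifold.maximalAtlas (𝓡 (m + 1)) ∞ M := IsManifold.chart_mem_maximalAtlas z
  have he2 : e ∈ IsManifold.maximalAtlas (𝓡 (m + 1)) 2 M := IsManifold.maximalAtlas_subset_of_le (by norm_cast) he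
  have hze : z ∈ e.source := mem_chart_source _ z
  have hfd : MDifferentiableAt (𝓡 (m + 1)) 𝓘(ℝ, ℝ) f z := hf.mdifferentiableAt (by norm_cast)
  have hφd : HasDerivAt φ (deriv φ (f z)) (f z) := (hφ.differentiableAt (by norm_cast)).hasDerivAt
  have hcrit : IsMCriticalPt (𝓡 (m + 1)) (fun y => φ (f y)) z := (isMCriticalPt_real_comp_iff' hφd hd hfd).2 hz
  have hg2 : ContMDiffAt (𝓡 (m + 1)) 𝓘(ℝ, ℝ) 2 (fun y => φ (f y)) z :=
    (hφ.contMDiffAt).comp z hf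
  -- the chart Hessians
  have hH : hessianInChart (𝓡 (m + 1)) e (fun y => φ (f y)) z = deriv φ (f z) • hessianInChart (𝓡 (m + 1)) e f z := by
    refine LinearMap.ext fun v => LinearMap.ext fun w => ?_
    rw [hessianInChart_real_comp_apply hφ hf hz he hze]
    rfl
  have hnd₁ := nondegenerate_mhessian_iff hg2 hcrit he2 hze
  have hnd₂ := nondegenerate_mhessian_iff hf hz he2 hze
  have hidx₁ := morseIndex_eq_sigNeg_hessianInChart hg2 hcrit he2 hze
  have hidx₂ := morseIndex_eq_sigNeg_hessianInChart hf hz he2 hze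
  refine ⟨hcrit, ?_, ?_, ?_⟩
  · rw [hnd₁, hnd₂, hH, LinearMap.BilinForm.nondegenerate_smul_iff _ hd]
  · intro hpos
    rw [hidx₁, hidx₂, hH, LinearMap.BilinForm.sigNeg_smul_of_pos' _ hpos]
  · intro hneg hfnd
    rw [hidx₁, hidx₂, hH]
    have hsymm : (hessianInChart (𝓡 (m + 1)) e f z).IsSymm := by
      refine ⟨fun v w => ?_⟩
      rw [RegularLevel.hessianInChart_apply_eq, RegularLevel.hessianInChart_apply_eq]
      have hτ : ContDiffAt ℝ 2 (f ∘ e.symm) (e z) := by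
        have := contDiffAt_comp_extend_symm hf he2 hze
        simpa using this
      exact (hτ.isSymmSndFDerivAt (by simp)).eq v w
    have := LinearMap.BilinForm.sigNeg_smul_of_neg ((hnd₂).1 hfnd) hsymm hneg
    rw [finrank_euclideanSpace_fin] at this
    exact this

end RealComp

/-! ### Flow-invariance of the top height on the band -/

section Band

variable {X : Type u} [TopologicalSpace X] [T2Space X] [CompactSpace X] [ChartedSpace (𝔼 4) X]
  [IsManifold (𝓡 4) ∞ X]
  {f : X → ℝ} {ξ : Π x : X, TangentSpace (𝓡 4) x} {a η : ℝ} {ι : Type} [Fintype ι]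
  (H : HandleBoxes f ξ a η ι)
  {hξ : ContMDiff (𝓡 4) (𝓡 4).tangent ∞ fun x => (⟨x, ξ x⟩ : TangentBundle (𝓡 4) X)}
  {h : IsRegularLevel (𝓡 4) f a} {φ : RegularLevel h → ℝ} {h₂ TP χlo χhi : ℝ → ℝ} {Smax Smin Psw : ℝ}

namespace HandleBoxes

omit [Fintype ι] in
/-- `P_j` is constant along an orbit for small times, at a point of `source_j`. [cite: MilnorHCobordism1965, proof of Thm. 3.12] -/
theorem P_flow_eventuallyEq {j : ι} {z : X} (hz : z ∈ (H.box j).chart.source) :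
    ∀ᶠ t in 𝓝 (0 : ℝ), H.P j (flow hξ z t) = H.P j z := by
  have hθ : IsFlowOf (𝓡 4) ξ (flowθ hξ) := (isSmoothFlow_flow hξ).isFlowOf
  -- a symmetric interval of times on which the orbit stays in the chart domain
  have hcont : Continuous fun t : ℝ => flow hξ z t := continuous_flow hξ z
  have hopen : IsOpen {t : ℝ | flow hξ z t ∈ (H.box j).chart.source} :=
    (H.box j).chart.open_source.preimage hcont
  have h0 : (0 : ℝ) ∈ {t : ℝ | flow hξ z t ∈ (H.box j).chart.source} := by simpa using hz
  obtain ⟨δ, hδ, hball⟩ := Metric.isOpen_iff.1 hopen 0 h0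
  filter_upwards [Metric.ball_mem_nhds (0 : ℝ) hδ] with t ht
  have hsub : ∀ r, |r| ≤ |t| → flow hξ z r ∈ (H.box j).chart.source := fun r hr => by
    apply hball
    rw [Metric.mem_ball, dist_zero_right, Real.norm_eq_abs]
    rw [Metric.mem_ball, dist_zero_right, Real.norm_eq_abs] at ht
    exact lt_of_le_of_lt hr ht
  rcases le_or_gt 0 t with ht0 | ht0
  · have hsrc : ∀ r ∈ Icc 0 t, flowθ hξ (r, z) ∈ (H.box j).chart.source := fun r hr =>
      hsub r (by rw [abs_of_nonneg hr.1, abs_of_nonneg ht0]; exact hr.2)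
    have := hθ.sqSumLT_mul_sqSumGE_coord_eq (H.box j) ht0 hsrc
    simpa [flowθ, flow_zero, P_def, A_def, B_def] using this
  · have hsrc : ∀ r ∈ Icc t 0, flowθ hξ (r, z) ∈ (H.box j).chart.source := fun r hr =>
      hsub r (by rw [abs_of_nonpos hr.2, abs_of_neg ht0]; linarith [hr.1])
    have := hθ.sqSumLT_mul_sqSumGE_coord_eq (H.box j) ht0.le hsrc
    simpa [flowθ, flow_zero, P_def, A_def, B_def] using this.symm

/-- **The raw top height is constant along orbits for small times**, at every point of the
band. [cite: GayKirby2016, §4, Lemma 14] -/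
theorem topRaw_flow_eventuallyEq (hgl : IsGradientLike (𝓡 4) f ξ) (hfM : IsMorse (𝓡 4) f)
    {P₁ v₁ : ℝ} (hPsw0 : 0 < Psw) (hPsw : 2 * Psw ≤ η ^ 2) (hP₁ : 2 * P₁ < Psw)
    (hTP₂ : ∀ P, 2 * P₁ ≤ P → TP P = Smax) (hh₂v : ∀ t ≤ v₁, h₂ t = Smax)
    (hφv : ∀ j (y : RegularLevel h), y.1 ∈ (H.box j).chart.source → H.P j y.1 < 2 * Psw → φ y ≤ v₁)
    {z : X} (hf₁ : a - η < f z) (hf₂ : f z < a + 2 * η) :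
    ∀ᶠ t in 𝓝 (0 : ℝ), H.topRaw hξ h φ h₂ TP Smax Psw (flow hξ z t) = H.topRaw hξ h φ h₂ TP Smax Psw z := by
  have hη := H.eta_pos
  have hcontf : Continuous f := hfM.contMDiff.continuous
  have horbit : Continuous fun t : ℝ => flow hξ z t := continuous_flow hξ z
  have horbit0 : Tendsto (fun t : ℝ => flow hξ z t) (𝓝 0) (𝓝 z) := by
    have := horbit.tendsto 0; simpa using this
  have hband : ∀ᶠ w in 𝓝 z, a - η < f w ∧ f w < a + 2 * η :=
    (hcontf.continuousAt.eventually (Ioo_mem_nhds hf₁ hf₂)).mono fun w hw => hw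
  by_cases h1 : ∃ j, z ∈ H.swSet Psw j
  · obtain ⟨j, hz⟩ := h1
    filter_upwards [horbit0.eventually ((H.isOpen_swSet Psw j).mem_nhds hz), H.P_flow_eventuallyEq (hξ := hξ) hz.1]
      with t ht hP
    rw [H.topRaw_of_mem_swSet ht, H.topRaw_of_mem_swSet hz, hP]
  · push Not at h1
    by_cases h2 : ∃ j, z ∈ (H.box j).chart.source ∧ H.P j z < 2 * Psw
    · obtain ⟨j, hzsrc, hzP⟩ := h2
      have hzP' : Psw ≤ H.P j z := by
        by_contra hlt; push Not at hlt; exact h1 j ⟨hzsrc, hlt⟩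
      have hcP : ContinuousAt (H.P j) z :=
        (H.continuousOn_P j).continuousAt ((H.box j).chart.open_source.mem_nhds hzsrc)
      have hnear : ∀ᶠ w in 𝓝 z, H.topRaw hξ h φ h₂ TP Smax Psw w = Smax := by
        filter_upwards [(H.box j).chart.open_source.mem_nhds hzsrc,
          hcP.eventually (Ioo_mem_nhds (show 2 * P₁ < H.P j z by linarith) hzP), hband] with w hw hwP hwf
        exact H.topRaw_eq_of_mem_collar hgl hfM hPsw hTP₂ hh₂v hφv hw hwP.1 hwP.2 hwf.1 hwf.2
      have hz0 : H.topRaw hξ h φ h₂ TP Smax Psw z = Smax := hnear.self_of_nhds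
      filter_upwards [horbit0.eventually hnear] with t ht
      rw [ht, hz0]
    · push Not at h2
      have hev1 : ∀ i, ∀ᶠ w in 𝓝 z, w ∉ H.swSet Psw i := by
        intro i
        by_cases hi : z ∈ (H.box i).chart.source
        · have hcP : ContinuousAt (H.P i) z :=
            (H.continuousOn_P i).continuousAt ((H.box i).chart.open_source.mem_nhds hi)
          have hge : Psw < H.P i z := by linarith [h2 i hi]
          filter_upwards [hcP.eventually (Ioi_mem_nhds hge)] with w hw hwS
          exact absurd hwS.2 (not_lt.2 (le_of_lt hw))
        · exact H.eventually_not_mem_swSet_of_not_mem_source (by nlinarith) hcontf hi hf₁ hf₂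
      have hnear : ∀ᶠ w in 𝓝 z, H.topRaw hξ h φ h₂ TP Smax Psw w = satLift hξ h φ h₂ Smax w := by
        filter_upwards [Filter.eventually_all.2 hev1] with w hw
        exact H.topRaw_of_forall_not_mem hw
      have hz0 := hnear.self_of_nhds
      filter_upwards [horbit0.eventually hnear] with t ht
      rw [ht, hz0, satLift_flow hgl hfM]

/-- **The top height is constant along orbits for small times** at every band point where
`χ_lo(s) = χ_hi(s) = 1` nearby. [cite: GayKirby2016, §4, Lemma 14] -/
theorem topHeight_flow_eventuallyEq (hgl : IsGradientLike (𝓡 4) f ξ) (hfM : IsMorse (𝓡 4) f)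
    {P₁ v₁ : ℝ} (hPsw0 : 0 < Psw) (hPsw : 2 * Psw ≤ η ^ 2) (hP₁ : 2 * P₁ < Psw)
    (hTP₂ : ∀ P, 2 * P₁ ≤ P → TP P = Smax) (hh₂v : ∀ t ≤ v₁, h₂ t = Smax)
    (hφv : ∀ j (y : RegularLevel h), y.1 ∈ (H.box j).chart.source → H.P j y.1 < 2 * Psw → φ y ≤ v₁)
    {z : X} (hf₁ : a - η < f z) (hf₂ : f z < a + 2 * η)
    (hplateau : ∀ᶠ s in 𝓝 (f z - a), χlo s = 1 ∧ χhi s = 1) :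
    ∀ᶠ t in 𝓝 (0 : ℝ), H.topHeight hξ h φ h₂ TP χlo χhi Smax Smin Psw (flow hξ z t) =
      H.topHeight hξ h φ h₂ TP χlo χhi Smax Smin Psw z := by
  have hcontf : Continuous f := hfM.contMDiff.continuous
  have horbit0 : Tendsto (fun t : ℝ => flow hξ z t) (𝓝 0) (𝓝 z) := by
    have := (continuous_flow hξ z).tendsto 0; simpa using this
  have hs : Tendsto (fun w => f w - a) (𝓝 z) (𝓝 (f z - a)) :=
    (hcontf.continuousAt.sub continuousAt_const).tendsto
  have hpl : ∀ᶠ w in 𝓝 z, χlo (f w - a) = 1 ∧ χhi (f w - a) = 1 := hs.eventually hplateau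
  have hz1 := hpl.self_of_nhds
  filter_upwards [horbit0.eventually hpl,
    H.topRaw_flow_eventuallyEq hgl hfM hPsw0 hPsw hP₁ hTP₂ hh₂v hφv hf₁ hf₂] with t ht hraw
  rw [H.topHeight_of_eq_one ht.1 ht.2, H.topHeight_of_eq_one hz1.1 hz1.2, hraw]

/-- **`ξ(T) = 0` on the plateau of the band.** [cite: GayKirby2016, §4, Lemma 14] -/
theorem mlineDeriv_topHeight_eq_zero (hgl : IsGradientLike (𝓡 4) f ξ) (hfM : IsMorse (𝓡 4) f)
    (hT : ContMDiff (𝓡 4) 𝓘(ℝ, ℝ) ∞ (H.topHeight hξ h φ h₂ TP χlo χhi Smax Smin Psw))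
    {P₁ v₁ : ℝ} (hPsw0 : 0 < Psw) (hPsw : 2 * Psw ≤ η ^ 2) (hP₁ : 2 * P₁ < Psw)
    (hTP₂ : ∀ P, 2 * P₁ ≤ P → TP P = Smax) (hh₂v : ∀ t ≤ v₁, h₂ t = Smax)
    (hφv : ∀ j (y : RegularLevel h), y.1 ∈ (H.box j).chart.source → H.P j y.1 < 2 * Psw → φ y ≤ v₁)
    {z : X} (hf₁ : a - η < f z) (hf₂ : f z < a + 2 * η)
    (hplateau : ∀ᶠ s in 𝓝 (f z - a), χlo s = 1 ∧ χhi s = 1) :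
    mlineDeriv (𝓡 4) (H.topHeight hξ h φ h₂ TP χlo χhi Smax Smin Psw) z (ξ z) = 0 := by
  have hθ : IsFlowOf (𝓡 4) ξ (flowθ hξ) := (isSmoothFlow_flow hξ).isFlowOf
  have hder : HasDerivAt (fun t : ℝ => H.topHeight hξ h φ h₂ TP χlo χhi Smax Smin Psw (flow hξ z t))
      (mlineDeriv (𝓡 4) (H.topHeight hξ h φ h₂ TP χlo χhi Smax Smin Psw) (flow hξ z 0) (ξ (flow hξ z 0))) 0 :=
    hθ.hasDerivAt_apply hT z 0
  have hconst : HasDerivAt (fun t : ℝ => H.topHeight hξ h φ h₂ TP χlo χhi Smax Smin Psw (flow hξ z t)) 0 0 := by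
    refine (hasDerivAt_const (0 : ℝ) (H.topHeight hξ h φ h₂ TP χlo χhi Smax Smin Psw z)).congr_of_eventuallyEq ?_
    exact H.topHeight_flow_eventuallyEq hgl hfM hPsw0 hPsw hP₁ hTP₂ hh₂v hφv hf₁ hf₂ hplateau
  have := hder.unique hconst
  rwa [flow_zero] at this

end HandleBoxes

omit [T2Space X] [CompactSpace X] [IsManifold (𝓡 4) ∞ X] in
/-- **Chain rule along a tangent vector for `Γ(T, f)`**:
`v(Γ(T, f)) = DΓ(T z, f z)(v T, v f)`. [folklore] -/
theorem mlineDeriv_comp₂_eq {T : X → ℝ} {Γ : ℝ × ℝ → ℝ} {z : X}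
    (hT : MDifferentiableAt (𝓡 4) 𝓘(ℝ, ℝ) T z) (hf : MDifferentiableAt (𝓡 4) 𝓘(ℝ, ℝ) f z)
    (hΓ : DifferentiableAt ℝ Γ (T z, f z)) (v : TangentSpace (𝓡 4) z) :
    mlineDeriv (𝓡 4) (fun w => Γ (T w, f w)) z v =
      fderiv ℝ Γ (T z, f z) (mlineDeriv (𝓡 4) T z v, mlineDeriv (𝓡 4) f z v) := by
  have hpair : HasMFDerivAt (𝓡 4) 𝓘(ℝ, ℝ × ℝ) (fun w => (T w, f w)) z
      ((mfderiv (𝓡 4) 𝓘(ℝ, ℝ) T z).prod (mfderiv (𝓡 4) 𝓘(ℝ, ℝ) f z)) :=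
    hT.hasMFDerivAt.prodMk hf.hasMFDerivAt
  have hcomp : HasMFDerivAt (𝓡 4) 𝓘(ℝ, ℝ) (fun w => Γ (T w, f w)) z
      ((fderiv ℝ Γ (T z, f z)).comp ((mfderiv (𝓡 4) 𝓘(ℝ, ℝ) T z).prod (mfderiv (𝓡 4) 𝓘(ℝ, ℝ) f z))) :=
    HasMFDerivAt.comp z hΓ.hasFDerivAt.hasMFDerivAt hpair
  rw [mlineDeriv_def, hcomp.mfderiv, mlineDeriv_def, mlineDeriv_def]
  rfl

namespace HandleBoxes

/-- **Derivative along `ξ` of `Γ(T, f)`** on the plateau: `ξ(Γ(T, f)) = ∂₂Γ(T z, f z) · ξ(f)`.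
[cite: GayKirby2016, §4, Lemma 14] -/
theorem mlineDeriv_comp₂_topHeight (hgl : IsGradientLike (𝓡 4) f ξ) (hfM : IsMorse (𝓡 4) f)
    (hT : ContMDiff (𝓡 4) 𝓘(ℝ, ℝ) ∞ (H.topHeight hξ h φ h₂ TP χlo χhi Smax Smin Psw))
    {P₁ v₁ : ℝ} (hPsw0 : 0 < Psw) (hPsw : 2 * Psw ≤ η ^ 2) (hP₁ : 2 * P₁ < Psw)
    (hTP₂ : ∀ P, 2 * P₁ ≤ P → TP P = Smax) (hh₂v : ∀ t ≤ v₁, h₂ t = Smax)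
    (hφv : ∀ j (y : RegularLevel h), y.1 ∈ (H.box j).chart.source → H.P j y.1 < 2 * Psw → φ y ≤ v₁)
    {Γ : ℝ × ℝ → ℝ} {z : X} (hΓ : DifferentiableAt ℝ Γ (H.topHeight hξ h φ h₂ TP χlo χhi Smax Smin Psw z, f z))
    (hf₁ : a - η < f z) (hf₂ : f z < a + 2 * η)
    (hplateau : ∀ᶠ s in 𝓝 (f z - a), χlo s = 1 ∧ χhi s = 1) :
    mlineDeriv (𝓡 4) (fun w => Γ (H.topHeight hξ h φ h₂ TP χlo χhi Smax Smin Psw w, f w)) z (ξ z) =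
      fderiv ℝ Γ (H.topHeight hξ h φ h₂ TP χlo χhi Smax Smin Psw z, f z) (0, 1) *
        mlineDeriv (𝓡 4) f z (ξ z) := by
  rw [mlineDeriv_comp₂_eq ((hT z).mdifferentiableAt (by simp)) (hfM.contMDiff.mdifferentiableAt (by simp)) hΓ,
    H.mlineDeriv_topHeight_eq_zero hgl hfM hT hPsw0 hPsw hP₁ hTP₂ hh₂v hφv hf₁ hf₂ hplateau,
    fderiv_prod_apply']
  ring

/-- **No critical points where `∂₂Γ ≠ 0`**: on the plateau of the band, off the critical points
of `f`, `Γ(T, f)` is not critical wherever `∂₂Γ(T z, f z) ≠ 0`. [cite: GayKirby2016, §4, Lemma 14]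
[cite: MilnorHCobordism1965, Def. 3.1] -/
theorem not_isMCriticalPt_comp₂_topHeight (hgl : IsGradientLike (𝓡 4) f ξ) (hfM : IsMorse (𝓡 4) f)
    (hT : ContMDiff (𝓡 4) 𝓘(ℝ, ℝ) ∞ (H.topHeight hξ h φ h₂ TP χlo χhi Smax Smin Psw))
    {P₁ v₁ : ℝ} (hPsw0 : 0 < Psw) (hPsw : 2 * Psw ≤ η ^ 2) (hP₁ : 2 * P₁ < Psw)
    (hTP₂ : ∀ P, 2 * P₁ ≤ P → TP P = Smax) (hh₂v : ∀ t ≤ v₁, h₂ t = Smax)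
    (hφv : ∀ j (y : RegularLevel h), y.1 ∈ (H.box j).chart.source → H.P j y.1 < 2 * Psw → φ y ≤ v₁)
    {Γ : ℝ × ℝ → ℝ} {z : X} (hΓ : DifferentiableAt ℝ Γ (H.topHeight hξ h φ h₂ TP χlo χhi Smax Smin Psw z, f z))
    (h2 : fderiv ℝ Γ (H.topHeight hξ h φ h₂ TP χlo χhi Smax Smin Psw z, f z) (0, 1) ≠ 0)
    (hz : ¬ IsMCriticalPt (𝓡 4) f z) (hf₁ : a - η < f z) (hf₂ : f z < a + 2 * η)
    (hplateau : ∀ᶠ s in 𝓝 (f z - a), χlo s = 1 ∧ χhi s = 1) :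
    ¬ IsMCriticalPt (𝓡 4) (fun w => Γ (H.topHeight hξ h φ h₂ TP χlo χhi Smax Smin Psw w, f w)) z := by
  intro hc
  have h0 : mlineDeriv (𝓡 4) (fun w => Γ (H.topHeight hξ h φ h₂ TP χlo χhi Smax Smin Psw w, f w)) z (ξ z) = 0 := by
    rw [mlineDeriv_def]
    unfold IsMCriticalPt at hc
    rw [hc]; rfl
  rw [H.mlineDeriv_comp₂_topHeight hgl hfM hT hPsw0 hPsw hP₁ hTP₂ hh₂v hφv hΓ hf₁ hf₂ hplateau] at h0
  rcases mul_eq_zero.1 h0 with h' | h'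
  · exact h2 h'
  · exact absurd h' (hgl.mlineDeriv_pos z hz).ne'

end HandleBoxes

end Band

end Literature.Topology.FourManifolds

end
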